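import Literature.NumberTheory.Automorphic.LocalLanglandsGL
import HarnessLib

/-!
# Named fact: the local Langlands correspondence for `GL_n` matches supercuspidal classes with
irreducible parameters and square-integrable classes with indecomposable parameters
(Henniart 2002, Thm. 1.5 and §2; Harris–Taylor 2001, Thm. A; Zelevinsky 1980, Thm. 9.7)

Source: G. Henniart, *Une caractérisation de la correspondance de Langlands locale pour `GL(n)`*,
Bull. Soc. Math. France **130** (2002), 587–602 (doi:10.24033/bsmf.2431; pp. 588–596 read).  With
`G(n)` the isomorphism classes of Frobenius-semisimple `n`-dimensional Weil–Deligne representations,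
`G⁰(n) ⊂ G(n)` the irreducible ones, `G²(n)` the indecomposable ones, `A(n) ⊃ A⁰(n), A²(n)` the
smooth irreducible, supercuspidal, essentially square-integrable classes of `GL_n(F)`:

* Thm. 1.3 (Laumon–Rapoport–Stuhler, Harris–Taylor, Henniart): bijections `π⁰_n : G⁰(n) → A⁰(n)`;
* Thm. 1.5 and §2.9: the Langlands–Zelevinsky extension `π_n : G(n) → A(n)` is bijective, restricts
  to `π⁰_n` on `G⁰(n)` and preserves `L` and `ε` of all pairs;
* §2.3, §2.6–§2.7: `G²(n) = {ρ ⊗ St_m}`, `A²(n) = {St_m(ρ)}` (Zelevinsky 1980, 9.3: the unique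
  irreducible quotient of `i(ρ, νρ, …, ν^{m-1}ρ)`), and `π_n` restricts to the bijection
  `π² : G²(n) → A²(n)`, `ρ ⊗ St_m ↦ St_m(π⁰(ρ))`.

Hence: `π ∈ A(n)` is supercuspidal iff its parameter is irreducible, and every indecomposable
parameter is the parameter of an essentially square-integrable class; the latter classes are GENERIC
(Zelevinsky 1980, Thm. 9.7: `⟨Δ₁, …, Δ_r⟩` is non-degenerate iff no two segments are linked — a
single segment `Δ` gives `L(Δ) = St_m(ρ)`; non-degeneracy = existence of a Whittaker functional for
one, equivalently every, non-trivial `ψ`, the non-degenerate characters of `U_n` being conjugate under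
the diagonal torus).

## Tree form

`localLanglands_gl_indecomposable F hmul huniq hn hex hns d 𝓔 hd` — in the format of the accepted
`localLanglands_gl` (same file `LocalLanglandsGL`, same threaded `LocalGaloisGroup` facts, same
normalising pair `(d, 𝓔)` with `𝓔.artin F = d`), but asserted only for THE canonical Artin datum
(`d.IsCanonical`) and local constants normalised against the canonical Artin maps of all finite
extensions (as in print): there is a six-clause correspondence `rec` (`IsLocalLanglandsGL`) with
(i) `c` supercuspidal ↔ `rec_n c` irreducible (`n ≥ 1`), and (ii) every indecomposable
Frobenius-semisimple `τ` on `Fin n → ℂ` (`n ≥ 1`) is `≅ rec_n [π]` for some `π` generic for every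
continuous non-trivial `ψ` (`IsGeneric π.ρ ψ`).  Parameters are read on the representatives
`Quotient.out` of the classes in `Quotient (frobSemisimpleWDSetoid F n)`; both properties are
isomorphism invariants.

## Why (consumer; prose only)

Rigidity of pinned local Langlands data on GENERIC classes of rank `n ≥ 3` (summit `Langlands`:
items stmt-Langlands-13643 / 18745 stub `stub_recGL_eq_of_isGeneric_of_not_isSupercuspidal_three_le`,
stmt-Langlands-17925 stub `stub_genericRigidity_three_le`): the six clauses pin a second datum
against the first on generic classes by induction on the rank through Henniart 2002 Thm. 1.7 (a)
(`HenniartGaloisSideCharacterisation`), PROVIDED the indecomposable probes of lower rank are known to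
be parameters of generic classes and the parameter of a non-supercuspidal class is known to be
non-irreducible — exactly (ii) and (i), which the six clauses alone do not record.

## Mathlib search

Mathlib has no smooth representation theory of `p`-adic groups and no local Langlands correspondence
(`rg -i langlands`, `rg -i 'square.?integrable' Mathlib/RepresentationTheory`: nothing relevant); all
notions used (`IsLocalLanglandsGL`, `IrrClass.IsSupercuspidal`, `IsGeneric`,
`WeilDeligneRep.{IsFrobSemisimple, IsIrreducible, IsIndecomposable, IsEquivalent}`,
`frobSemisimpleWDSetoid`, `LocalArtinData.IsCanonical`) are the tree's.  Nothing is re-declared.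

## Deliberately NOT here

Essentially square-integrable representations as a notion (not in the tree; (ii) is phrased through
its two consequences that consumers need: genericity and the image); Henniart's uniqueness (already in
`localLanglands_gl`); the discharge `…_holds` (needs the construction of the correspondence and the
Bernstein–Zelevinsky classification).
-/

noncomputable section

open scoped MatrixGroups

namespace Literature.NumberTheory.Automorphic

open GaloisRepresentations

/-- **The local Langlands correspondence for `GL_n` matches supercuspidal classes with irreducible
parameters and essentially square-integrable classes with indecomposable parameters** (named fact,
D-0014).  Let `F` be a non-archimedean local field, `d` THE canonical local Artin datum
(`LocalArtinData.IsCanonical`: geometric Frobenius ↦ uniformiser, Henniart's normalisation §1.1) and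
`𝓔` a system of local constants normalised against the canonical Artin maps of all finite extensions.
Then there is a local Langlands correspondence `rec = (rec_n)_n` for the general linear groups over
`F` in the sense of the six-clause `IsLocalLanglandsGL F … d 𝓔 rec` (Harris–Taylor 2001, Thm. A;
Henniart 2002, Thm. 1.5 and §2.9) such that, for every `n ≥ 1`:
(i) a class `c ∈ Irr(GL_n(F))` is supercuspidal if and only if its parameter `rec_n c` is an
irreducible Weil–Deligne representation (Henniart 2002, Thm. 1.3 and Thm. 1.5 (i), §2.9: `π_n` is a
bijection `G(n) → A(n)` extending the bijection `π⁰_n : G⁰(n) → A⁰(n)`);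
(ii) every indecomposable Frobenius-semisimple `n`-dimensional Weil–Deligne representation
`τ ≅ ρ ⊗ St_m` is the parameter of a class which is generic for every non-trivial continuous
additive character `ψ` — namely of the essentially square-integrable class `St_m(π⁰(ρ))` (Henniart
2002, §2.3, §2.6–§2.7, §2.9: `π_n` restricts to a bijection `G²(n) → A²(n)`; Zelevinsky 1980,
Thm. 9.7: a one-segment representation `St_m(ρ) = L(Δ)` is non-degenerate, for any non-trivial `ψ`).
Parameters are read on the chosen representatives `Quotient.out` (both properties are isomorphism
invariants); genericity is `IsGeneric π.ρ ψ`.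
[cite: HenniartBSMF2002, Thm. 1.5 (i), §2.7 and §2.9] [cite: HarrisTaylorAMS2001, Thm. A]
[cite: Zelevinsky1980, Thm. 9.7] -/
def localLanglands_gl_indecomposable (F : Type) [Field F] [ValuativeRel F] [TopologicalSpace F]
    [IsNonarchimedeanLocalField F]
    (hmul : IsFrobPow.mul (F := F)) (huniq : IsFrobPow.unique (F := F))
    (hn : absInertia_normal F) (hex : exists_isFrobPow (F := F))
    (hns : WeilGroup.exists_subgroup_le_inertia_isOpen_of_continuous (F := F))
    (d : LocalArtinData F) (𝓔 : LocalEpsilonSystem F) (_hd : 𝓔.artin F = d) : Prop :=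
  d.IsCanonical →
  (∀ (E : Type) [Field E] [ValuativeRel E] [TopologicalSpace E] [IsNonarchimedeanLocalField E]
      [Algebra F E] [FiniteDimensional F E], (𝓔.artin E).IsCanonical) →
  ∃ rec : ∀ n : ℕ, IrrClass (GL (Fin n) F) → Quotient (frobSemisimpleWDSetoid F n),
    IsLocalLanglandsGL F hmul huniq hn hex hns d 𝓔 rec ∧
    (∀ n : ℕ, 0 < n → ∀ c : IrrClass (GL (Fin n) F),
      c.IsSupercuspidal ↔ ((rec n c).out.1).IsIrreducible) ∧
    (∀ n : ℕ, 0 < n → ∀ τ : WeilDeligneRep F ℂ (Fin n → ℂ), τ.IsFrobSemisimple →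
      τ.IsIndecomposable → ∃ π : SmoothIrrep (GL (Fin n) F),
        (∀ ψ : AddChar F Circle, ψ.IsContinuousNontrivial → IsGeneric π.ρ ψ) ∧
        ((rec n (IrrClass.mk π)).out.1).IsEquivalent τ)

/-- (i) specialised: under the named fact, the parameter of a NON-supercuspidal class (`n ≥ 1`) under
the witness correspondence is not irreducible. [cite: HenniartBSMF2002, Thm. 1.5 (i)] -/
theorem localLanglands_gl_indecomposable.not_isIrreducible_of_not_isSupercuspidal
    {F : Type} [Field F] [ValuativeRel F] [TopologicalSpace F] [IsNonarchimedeanLocalField F]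
    {rec : ∀ n : ℕ, IrrClass (GL (Fin n) F) → Quotient (frobSemisimpleWDSetoid F n)}
    (hirr : ∀ n : ℕ, 0 < n → ∀ c : IrrClass (GL (Fin n) F),
      c.IsSupercuspidal ↔ ((rec n c).out.1).IsIrreducible)
    {n : ℕ} (hn0 : 0 < n) {c : IrrClass (GL (Fin n) F)} (hc : ¬ c.IsSupercuspidal) :
    ¬ ((rec n c).out.1).IsIrreducible :=
  fun h => hc ((hirr n hn0 c).2 h)

end Literature.NumberTheory.Automorphic

end
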